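import Summits.CriticalPhenomena.PercolationContinuityZ3.Theorems.PercNearOneGluingAdditiveGluingCovTransferCertCheck

/-!
# `NoHeavyLowerTail` (crux stmt-CriticalPhenomena-4575), master-family hierarchy P3: the algebra of
# FOUR-copy (degree-4 tensor-Bernstein, "comb level 4") certificates and their Kronecker digit test

Support file (seat `prim-masterthm-p3`, polarisation / Bernstein hierarchy for Sahi's `E_k`;
`--supports stmt-CriticalPhenomena-4575`).  Measure-free layer: the four-copy analogue of
`…AdditiveGluingCovTransferCertAlgebra` (three copies) and `…NoHeavyLowerTailOneCutCertKronecker` (two copies), whose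
`mono`, `ML`, `InCube`, `digit`, `digit_of_sum`, `maskN`, `tabOf`, `enc2` it reuses.

Sahi's fourth-order functional `E₄(A,B,C,D)` of four events of the cube `{0,1}^m` under the product measure `μ_x` is a
signed sum of fifteen products of at most FOUR multilinear polynomials `ML T · ML U · ML V · ML W` (`T,…` = `0/1` corner
tables; missing factors = the constant table `1`).  Such a product regroups over KEYS `k : Fin m → Fin 5` (`k_i` = number of
the four copies in which coordinate `i` is open) with the degree-4 weights `bern5 t d = t^d (1 − t)^{4−d} ≥ 0` and the FIBRE
SUMS `pcoef4 T U V W k = Σ_{key4 g h l o = k} T g · U h · V l · W o` (`ML_mul4`).  Hence a signed quartic combination is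
nonnegative on the unit cube as soon as all its `5^m` fibre sums are (`quarticForm_nonneg`, the level-4 comb criterion =
the master-family statement (M⁺-4) of `run/shared/lean/prim/MASTER-FAMILY.md` §MASTER at one instance).  For INTEGER
tables the fibre sums are the base-`M` digits (base-5 POSITIONS) of `Σ_j s_j · KR5 T_j · KR5 U_j · KR5 V_j · KR5 W_j`
(`KR5 T = Σ_g T g · M^{e5 g}`, `e5 g = Σ_i g_i 5^i`; no carries: `e5 g + e5 h + e5 l + e5 o = E5 (key4 g h l o)`), and
`quarticCoef_nonneg_of_digit_ge` turns a lower bound on the digits (checked by the AND-mask test of `…OneCutCertCheck`)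
into the nonnegativity of every fibre sum.  `krL5`/`krN5` compute the Kronecker numbers of list tables by shifts.

Nothing here mentions percolation; no proposition about the crux is asserted.
-/

namespace Summit.CriticalPhenomena.PercolationContinuityZ3.Theorems.FourCopyCert

open Finset OneCutCert
open scoped BigOperators

variable {m : ℕ}

/-! ## Keys of four copies and the degree-4 Bernstein weights -/

/-- The digit of four bits: `a + b + c + d ∈ {0,…,4}`. [this work] -/
def bkey4 (a b c d : Bool) : Fin 5 :=
  ⟨a.toNat + b.toNat + c.toNat + d.toNat, by cases a <;> cases b <;> cases c <;> cases d <;> decide⟩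

/-- The key of four corners: `k_i = g_i + h_i + l_i + o_i`. [this work] -/
def key4 (g h l o : Fin m → Bool) : Fin m → Fin 5 := fun i => bkey4 (g i) (h i) (l i) (o i)

/-- The scaled degree-4 Bernstein weight of a digit: `t^d (1 − t)^{4−d}`. [this work] -/
def bern5 (t : ℝ) (d : Fin 5) : ℝ := t ^ (d : ℕ) * (1 - t) ^ (4 - (d : ℕ))

/-- The degree-4 weights are nonnegative on `[0,1]`. [folklore] -/
theorem bern5_nonneg {t : ℝ} (ht : 0 ≤ t ∧ t ≤ 1) (d : Fin 5) : 0 ≤ bern5 t d :=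
  mul_nonneg (pow_nonneg ht.1 _) (pow_nonneg (sub_nonneg.2 ht.2) _)

/-- One coordinate: the product of four Bernoulli factors is the Bernstein weight of their digit. [this work] -/
theorem pick4 (t : ℝ) (a b c d : Bool) :
    (if a then t else 1 - t) * (if b then t else 1 - t) * (if c then t else 1 - t) * (if d then t else 1 - t)
      = bern5 t (bkey4 a b c d) := by
  cases a <;> cases b <;> cases c <;> cases d <;>
    simp only [bern5, bkey4, Bool.toNat_true, Bool.toNat_false, Nat.reduceAdd, Nat.reduceSub, Bool.false_eq_true,
      if_true, if_false, pow_zero, pow_one] <;> ring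

/-- The product of four corner weights depends only on the key. [this work] -/
theorem mono4 (x : Fin m → ℝ) (g h l o : Fin m → Bool) :
    mono x g * mono x h * mono x l * mono x o = ∏ i, bern5 (x i) (key4 g h l o i) := by
  unfold mono
  rw [← Finset.prod_mul_distrib, ← Finset.prod_mul_distrib, ← Finset.prod_mul_distrib]
  exact Finset.prod_congr rfl fun i _ => pick4 (x i) (g i) (h i) (l i) (o i)

/-- The four-copy fibre sum of the key `k`: `Σ_{key4 g h l o = k} A g · B h · C l · D o`. [this work] -/
def pcoef4 {R : Type*} [CommRing R] (A B C D : (Fin m → Bool) → R) (k : Fin m → Fin 5) : R :=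
  ∑ g, ∑ h, ∑ l, ∑ o, if key4 g h l o = k then A g * B h * C l * D o else 0

/-- **Regrouping by keys (four copies).** [this work] -/
theorem sum4_key {R : Type*} [CommRing R] (A B C D : (Fin m → Bool) → R) (φ ψ χ ω : (Fin m → Bool) → R)
    (W : (Fin m → Fin 5) → R) (hW : ∀ g h l o, φ g * ψ h * χ l * ω o = W (key4 g h l o)) :
    (∑ g, A g * φ g) * (∑ h, B h * ψ h) * (∑ l, C l * χ l) * (∑ o, D o * ω o) = ∑ k, pcoef4 A B C D k * W k := by
  classical
  have h1 : ∀ g h l o : Fin m → Bool, A g * φ g * (B h * ψ h) * (C l * χ l) * (D o * ω o) =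
      ∑ k : Fin m → Fin 5, (if key4 g h l o = k then A g * B h * C l * D o else 0) * W k := by
    intro g h l o
    rw [Finset.sum_eq_single (key4 g h l o)]
    · rw [if_pos rfl, ← hW g h l o]; ring
    · intro k _ hk; rw [if_neg (Ne.symm hk), zero_mul]
    · intro hk; exact absurd (Finset.mem_univ _) hk
  calc (∑ g, A g * φ g) * (∑ h, B h * ψ h) * (∑ l, C l * χ l) * (∑ o, D o * ω o)
      = ∑ g, ∑ h, ∑ o, ∑ l, A g * φ g * (B h * ψ h) * (C l * χ l) * (D o * ω o) := by
        rw [Finset.sum_mul_sum, Finset.sum_mul, Finset.sum_mul]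
        refine Finset.sum_congr rfl fun g _ => ?_
        rw [Finset.sum_mul, Finset.sum_mul]
        refine Finset.sum_congr rfl fun h _ => ?_
        rw [Finset.mul_sum]
        refine Finset.sum_congr rfl fun o _ => ?_
        rw [Finset.mul_sum, Finset.sum_mul]
    _ = ∑ g, ∑ h, ∑ o, ∑ l, ∑ k, (if key4 g h l o = k then A g * B h * C l * D o else 0) * W k :=
        Finset.sum_congr rfl fun g _ => Finset.sum_congr rfl fun h _ => Finset.sum_congr rfl fun o _ =>
          Finset.sum_congr rfl fun l _ => h1 g h l o
    _ = ∑ g, ∑ h, ∑ o, ∑ k, ∑ l, (if key4 g h l o = k then A g * B h * C l * D o else 0) * W k :=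
        Finset.sum_congr rfl fun g _ => Finset.sum_congr rfl fun h _ => Finset.sum_congr rfl fun o _ =>
          Finset.sum_comm
    _ = ∑ g, ∑ h, ∑ k, ∑ o, ∑ l, (if key4 g h l o = k then A g * B h * C l * D o else 0) * W k :=
        Finset.sum_congr rfl fun g _ => Finset.sum_congr rfl fun h _ => Finset.sum_comm
    _ = ∑ g, ∑ k, ∑ h, ∑ o, ∑ l, (if key4 g h l o = k then A g * B h * C l * D o else 0) * W k :=
        Finset.sum_congr rfl fun g _ => Finset.sum_comm
    _ = ∑ k, ∑ g, ∑ h, ∑ o, ∑ l, (if key4 g h l o = k then A g * B h * C l * D o else 0) * W k :=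
        Finset.sum_comm
    _ = ∑ k, pcoef4 A B C D k * W k := by
        unfold pcoef4
        refine Finset.sum_congr rfl fun k _ => ?_
        simp_rw [Finset.sum_mul]
        exact Finset.sum_congr rfl fun g _ => Finset.sum_congr rfl fun h _ => Finset.sum_comm

/-- **Product of four multilinear polynomials in the degree-4 Bernstein basis.** [this work] -/
theorem ML_mul4 (A B C D : (Fin m → Bool) → ℝ) (x : Fin m → ℝ) :
    ML A x * ML B x * ML C x * ML D x = ∑ k, pcoef4 A B C D k * ∏ i, bern5 (x i) (k i) := by
  unfold ML
  exact sum4_key A B C D (mono x) (mono x) (mono x) (mono x) (fun k => ∏ i, bern5 (x i) (k i)) (mono4 x)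

/-! ## Signed quartic combinations with integer tables -/

/-- A signed combination of `J` products of four multilinear polynomials with integer corner tables. [this work] -/
def quarticForm {J : Type*} [Fintype J] (s : J → ℤ) (X Y Z W : J → (Fin m → Bool) → ℤ) (x : Fin m → ℝ) : ℝ :=
  ∑ j, (s j : ℝ) * (ML (fun g => (X j g : ℝ)) x * ML (fun g => (Y j g : ℝ)) x * ML (fun g => (Z j g : ℝ)) x
    * ML (fun g => (W j g : ℝ)) x)

/-- Its integer fibre sums (the level-4 comb coefficients). [this work] -/
def quarticCoef {J : Type*} [Fintype J] (s : J → ℤ) (X Y Z W : J → (Fin m → Bool) → ℤ) (k : Fin m → Fin 5) : ℤ :=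
  ∑ j, s j * pcoef4 (X j) (Y j) (Z j) (W j) k

/-- Casting integer fibre sums. [this work] -/
theorem pcoef4_cast (A B C D : (Fin m → Bool) → ℤ) (k : Fin m → Fin 5) :
    pcoef4 (fun g => (A g : ℝ)) (fun g => (B g : ℝ)) (fun g => (C g : ℝ)) (fun g => (D g : ℝ)) k
      = ((pcoef4 A B C D k : ℤ) : ℝ) := by
  unfold pcoef4
  push_cast
  rfl

/-- The quartic form in the degree-4 Bernstein basis. [this work] -/
theorem quarticForm_eq {J : Type*} [Fintype J] (s : J → ℤ) (X Y Z W : J → (Fin m → Bool) → ℤ) (x : Fin m → ℝ) :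
    quarticForm s X Y Z W x = ∑ k, (quarticCoef s X Y Z W k : ℝ) * ∏ i, bern5 (x i) (k i) := by
  unfold quarticForm quarticCoef
  simp_rw [ML_mul4, pcoef4_cast, Finset.mul_sum]
  rw [Finset.sum_comm]
  refine Finset.sum_congr rfl fun k _ => ?_
  push_cast
  rw [Finset.sum_mul]
  exact Finset.sum_congr rfl fun j _ => by ring

/-- **The fibre criterion (level 4)**: fibrewise nonnegativity implies nonnegativity on the cube. [this work] -/
theorem quarticForm_nonneg {J : Type*} [Fintype J] {s : J → ℤ} {X Y Z W : J → (Fin m → Bool) → ℤ}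
    (hk : ∀ k, 0 ≤ quarticCoef s X Y Z W k) {x : Fin m → ℝ} (hx : InCube x) : 0 ≤ quarticForm s X Y Z W x := by
  rw [quarticForm_eq]
  exact Finset.sum_nonneg fun k _ =>
    mul_nonneg (by exact_mod_cast hk k) (Finset.prod_nonneg fun i _ => bern5_nonneg (hx i) (k i))

/-! ## Base-5 positions and Kronecker numbers -/

/-- Position of a corner: `Σ_i g_i 5^i`. [this work] -/
def e5 (g : Fin m → Bool) : ℕ := ∑ i, (g i).toNat * 5 ^ (i : ℕ)

/-- Position of a key: `Σ_i k_i 5^i`. [this work] -/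
def E5 (k : Fin m → Fin 5) : ℕ := ∑ i, (k i : ℕ) * 5 ^ (i : ℕ)

/-- Positions add digitwise, without carries: `e5 g + e5 h + e5 l + e5 o = E5 (key4 g h l o)`. [this work] -/
theorem e5_add4 (g h l o : Fin m → Bool) : e5 g + e5 h + e5 l + e5 o = E5 (key4 g h l o) := by
  unfold e5 E5
  rw [← Finset.sum_add_distrib, ← Finset.sum_add_distrib, ← Finset.sum_add_distrib]
  refine Finset.sum_congr rfl fun i _ => ?_
  rw [show ((key4 g h l o i : Fin 5) : ℕ) = (g i).toNat + (h i).toNat + (l i).toNat + (o i).toNat from rfl]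
  ring

/-- `E5` is Mathlib's `finFunctionFinEquiv`. [this work] -/
theorem E5_eq (k : Fin m → Fin 5) : E5 k = (finFunctionFinEquiv k : ℕ) := by
  rw [finFunctionFinEquiv_apply]; rfl

/-- The Kronecker number of an integer corner table in base `M`, base-5 positions: `Σ_g T g · M^{e5 g}`. [this work] -/
def KR5 (M : ℕ) (T : (Fin m → Bool) → ℤ) : ℤ := ∑ g, T g * (M : ℤ) ^ e5 g

/-- **Product of four Kronecker numbers = fibre sums in base `M`.** [this work] -/
theorem KR5_mul4 (M : ℕ) (A B C D : (Fin m → Bool) → ℤ) :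
    KR5 M A * KR5 M B * KR5 M C * KR5 M D = ∑ k, pcoef4 A B C D k * (M : ℤ) ^ E5 k := by
  unfold KR5
  exact sum4_key A B C D _ _ _ _ (fun k => (M : ℤ) ^ E5 k)
    (fun g h l o => by rw [← pow_add, ← pow_add, ← pow_add, e5_add4])

/-- The certificate number `Z = Σ_j s_j · KR5 X_j · KR5 Y_j · KR5 Z_j · KR5 W_j`. [this work] -/
def quarticZ {J : Type*} [Fintype J] (M : ℕ) (s : J → ℤ) (X Y Z W : J → (Fin m → Bool) → ℤ) : ℤ :=
  ∑ j, s j * (KR5 M (X j) * KR5 M (Y j) * KR5 M (Z j) * KR5 M (W j))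

/-- `Z = Σ_k c_k M^{E5 k}`. [this work] -/
theorem quarticZ_eq {J : Type*} [Fintype J] (M : ℕ) (s : J → ℤ) (X Y Z W : J → (Fin m → Bool) → ℤ) :
    quarticZ M s X Y Z W = ∑ k, quarticCoef s X Y Z W k * (M : ℤ) ^ E5 k := by
  unfold quarticZ quarticCoef
  simp_rw [KR5_mul4, Finset.mul_sum]
  rw [Finset.sum_comm]
  refine Finset.sum_congr rfl fun k _ => ?_
  rw [Finset.sum_mul]
  exact Finset.sum_congr rfl fun j _ => by ring

/-- A bound on all integer fibre sums. [this work] -/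
def CoefBound4 {J : Type*} [Fintype J] (s : J → ℤ) (X Y Z W : J → (Fin m → Bool) → ℤ) (K : ℕ) : Prop :=
  ∀ k, |quarticCoef s X Y Z W k| < K

/-- **Digit criterion (four copies).** If every fibre sum is `< K = 2^(s-1)` in absolute value,
`Z + K·Σ_{j<5^m} (2^s)^j` equals the natural number `N`, and all `5^m` lowest base-`2^s` digits of `N` are `≥ K`, then every
fibre sum is nonnegative. [this work] -/
theorem quarticCoef_nonneg_of_digit_ge {J : Type*} [Fintype J] {s : J → ℤ} {X Y Z W : J → (Fin m → Bool) → ℤ} {σ : ℕ}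
    (hσ : 0 < σ) (hB : CoefBound4 s X Y Z W (2 ^ (σ - 1))) (N : ℕ)
    (hN : (N : ℤ) = quarticZ (2 ^ σ) s X Y Z W + ∑ j : Fin (5 ^ m), (2 : ℤ) ^ (σ - 1) * (2 ^ σ) ^ (j : ℕ))
    (hdig : ∀ j : ℕ, j < 5 ^ m → 2 ^ (σ - 1) ≤ digit (2 ^ σ) N j) :
    ∀ k, 0 ≤ quarticCoef s X Y Z W k := by
  have hK2 : (2 : ℕ) ^ σ = 2 * 2 ^ (σ - 1) := by
    rw [← pow_succ']; congr 1; omega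
  let d : Fin (5 ^ m) → ℕ := fun j => (quarticCoef s X Y Z W (finFunctionFinEquiv.symm j) + 2 ^ (σ - 1)).toNat
  have hdnn : ∀ k, 0 ≤ quarticCoef s X Y Z W k + 2 ^ (σ - 1) := fun k => by
    have := (abs_lt.1 (hB k)).1; push_cast at this ⊢; linarith
  have hK2z : (2 : ℤ) ^ σ = 2 * 2 ^ (σ - 1) := by exact_mod_cast hK2
  have hdlt : ∀ j, d j < 2 ^ σ := fun j => by
    have h1 := (abs_lt.1 (hB (finFunctionFinEquiv.symm j))).2
    have h2 := hdnn (finFunctionFinEquiv.symm j)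
    have h3 : ((d j : ℕ) : ℤ) < (2 : ℤ) ^ σ := by
      simp only [d]
      rw [Int.toNat_of_nonneg h2, hK2z]
      push_cast at h1 ⊢
      linarith
    exact_mod_cast h3
  have hNsum : N = ∑ j : Fin (5 ^ m), d j * (2 ^ σ) ^ (j : ℕ) := by
    zify
    rw [hN, quarticZ_eq, ← (Equiv.sum_comp finFunctionFinEquiv.symm
      (fun k => quarticCoef s X Y Z W k * ((2 ^ σ : ℕ) : ℤ) ^ E5 k)), ← Finset.sum_add_distrib]
    refine Finset.sum_congr rfl fun j _ => ?_
    have hEj : E5 (finFunctionFinEquiv.symm j) = (j : ℕ) := by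
      rw [E5_eq, Equiv.apply_symm_apply]
    rw [hEj]
    simp only [d]
    rw [Int.toNat_of_nonneg (hdnn _)]
    push_cast
    ring
  intro k
  have hj := hdig (finFunctionFinEquiv k) (finFunctionFinEquiv k).2
  rw [hNsum] at hj
  have hdd := digit_of_sum _ (pow_pos (by norm_num) σ) _ d hdlt (finFunctionFinEquiv k)
  rw [hdd] at hj
  have h2 := hdnn k
  simp only [d, Equiv.symm_apply_apply] at hj
  zify at hj
  rw [Int.toNat_of_nonneg h2] at hj
  linarith

/-- Fibre sums of `0/1`-bounded tables are at most `16^m` in absolute value. [this work] -/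
theorem abs_pcoef4_le (A B C D : (Fin m → Bool) → ℤ) (hA : ∀ g, |A g| ≤ 1) (hB : ∀ g, |B g| ≤ 1)
    (hC : ∀ g, |C g| ≤ 1) (hD : ∀ g, |D g| ≤ 1) (k : Fin m → Fin 5) : |pcoef4 A B C D k| ≤ 16 ^ m := by
  classical
  unfold pcoef4
  have hterm : ∀ g h l o : Fin m → Bool, |(if key4 g h l o = k then A g * B h * C l * D o else 0)| ≤ 1 := by
    intro g h l o
    split_ifs
    · rw [abs_mul, abs_mul, abs_mul]
      exact mul_le_one₀ (mul_le_one₀ (mul_le_one₀ (hA g) (abs_nonneg _) (hB h)) (abs_nonneg _) (hC l))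
        (abs_nonneg _) (hD o)
    · simp
  have hcard : (Finset.univ : Finset (Fin m → Bool)).card = 2 ^ m := by
    rw [Finset.card_univ, Fintype.card_fun, Fintype.card_bool, Fintype.card_fin]
  calc |∑ g, ∑ h, ∑ l, ∑ o, (if key4 g h l o = k then A g * B h * C l * D o else 0)|
      ≤ ∑ g, |∑ h, ∑ l, ∑ o, (if key4 g h l o = k then A g * B h * C l * D o else 0)| :=
        Finset.abs_sum_le_sum_abs _ _
    _ ≤ ∑ g : Fin m → Bool, ∑ h : Fin m → Bool, ∑ l : Fin m → Bool, ∑ o : Fin m → Bool, (1 : ℤ) := by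
        refine Finset.sum_le_sum fun g _ => (Finset.abs_sum_le_sum_abs _ _).trans (Finset.sum_le_sum fun h _ =>
          (Finset.abs_sum_le_sum_abs _ _).trans (Finset.sum_le_sum fun l _ =>
            (Finset.abs_sum_le_sum_abs _ _).trans (Finset.sum_le_sum fun o _ => hterm g h l o)))
    _ = 16 ^ m := by
        simp only [Finset.sum_const, hcard, nsmul_eq_mul, mul_one]
        push_cast
        rw [show (16 : ℤ) = 2 ^ 4 by norm_num, ← pow_mul]
        ring

/-! ## Base-5 Kronecker numbers of list tables, by shifts -/

/-- `e5` of a `snoc`. [this work] -/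
theorem e5_snoc (g : Fin m → Bool) (b : Bool) :
    e5 (Fin.snoc g b : Fin (m + 1) → Bool) = e5 g + b.toNat * 5 ^ m := by
  unfold e5
  rw [Fin.sum_univ_castSucc]
  simp only [Fin.snoc_castSucc, Fin.snoc_last, Fin.val_castSucc, Fin.val_last]

/-- Fast base-`2^s` Kronecker number (base-5 positions) of an integer list-table of length `2^L`. [this work] -/
def krL5 (s : ℕ) : ℕ → List ℤ → ℤ
  | 0, l => l.getD 0 0
  | L + 1, l => krL5 s L (l.take (2 ^ L)) + krL5 s L (l.drop (2 ^ L)) * (2 : ℤ) ^ (s * 5 ^ L)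

/-- **Correctness of `krL5`**: `krL5 s L l = KR5 (2^s) (tabOf l)` for `l.length = 2^L`. [this work] -/
theorem krL5_eq : ∀ (s L : ℕ) (l : List ℤ), l.length = 2 ^ L → krL5 s L l = KR5 (2 ^ s) (tabOf (m := L) l)
  | s, 0, l, hl => by
    unfold krL5 KR5 tabOf
    simp [enc2, e5]
  | s, L + 1, l, hl => by
    have h1 : (l.take (2 ^ L)).length = 2 ^ L := by rw [List.length_take, hl, pow_succ]; omega
    have h2 : (l.drop (2 ^ L)).length = 2 ^ L := by rw [List.length_drop, hl, pow_succ]; omega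
    unfold krL5
    rw [krL5_eq s L _ h1, krL5_eq s L _ h2]
    unfold KR5
    rw [sum_corner_succ, Finset.sum_mul]
    congr 1
    · refine Finset.sum_congr rfl fun g _ => ?_
      unfold tabOf
      rw [enc2_snoc, e5_snoc]
      simp only [Bool.toNat_false, zero_mul, add_zero]
      rw [List.getD_eq_getElem?_getD, List.getD_eq_getElem?_getD, List.getElem?_take_of_lt (enc2_lt g)]
    · refine Finset.sum_congr rfl fun g _ => ?_
      unfold tabOf
      rw [enc2_snoc, e5_snoc]
      simp only [Bool.toNat_true, one_mul]
      rw [List.getD_eq_getElem?_getD, List.getD_eq_getElem?_getD, List.getElem?_drop, add_comm (2 ^ L),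
        pow_add, mul_assoc, two_pow_mul_cast]

/-- Fast Kronecker number of a list-table of NATURALS (base-5 positions), by shifts. [this work] -/
def krN5 (s : ℕ) : ℕ → List ℕ → ℕ
  | 0, l => l.getD 0 0
  | L + 1, l => krN5 s L (l.take (2 ^ L)) + (krN5 s L (l.drop (2 ^ L))) <<< (s * 5 ^ L)

/-- `krN5` agrees with `krL5` on the casts. [this work] -/
theorem krN5_eq_krL5 : ∀ (s L : ℕ) (l : List ℕ), (krN5 s L l : ℤ) = krL5 s L (l.map ((↑) : ℕ → ℤ))
  | s, 0, l => by simp [krN5, krL5, List.getD_eq_getElem?_getD, List.getElem?_map]; cases l[0]? <;> simp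
  | s, L + 1, l => by
    unfold krN5 krL5
    rw [Nat.shiftLeft_eq, ← List.map_take, ← List.map_drop]
    push_cast
    rw [krN5_eq_krL5 s L, krN5_eq_krL5 s L]

/-- **Correctness of `krN5`.** [this work] -/
theorem krN5_eq (s L : ℕ) (l : List ℕ) (hl : l.length = 2 ^ L) :
    (krN5 s L l : ℤ) = KR5 (2 ^ s) (tabOf (m := L) (l.map ((↑) : ℕ → ℤ))) := by
  rw [krN5_eq_krL5, krL5_eq s L _ (by rw [List.length_map, hl])]

/-- The level-4 offset `2^(σ-1) · Σ_{j < 5^m} (2^σ)^j` in closed form. [this work] -/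
def offQ (σ m : ℕ) : ℤ := 2 ^ (σ - 1) * (((2 : ℤ) ^ (σ * 5 ^ m) - 1) / (2 ^ σ - 1))

/-- The closed form of the offset is the mask number `maskN σ (5^m)`. [this work] -/
theorem offQ_eq (σ m : ℕ) (hσ : 0 < σ) : offQ σ m = (maskN σ (5 ^ m) : ℤ) := by
  unfold offQ
  rw [off_eq σ (5 ^ m) hσ, maskN_eq_sum σ hσ, Finset.mul_sum]

end Summit.CriticalPhenomena.PercolationContinuityZ3.Theorems.FourCopyCert
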